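import Literature.NumberTheory.Automorphic.UnitaryGroupBorelTruncation
import HarnessLib

/-!
# Arthur's truncated kernel `k^T(x)` for the quasi-split unitary group `U(J_N)` — the kernels
# `K`, `K_B` and `k^T` of the rank-one trace formula, statement layer
(Rogawski, *Automorphic Representations of Unitary Groups in Three Variables* (1990), §2.2,
pp. 12–14; Shokranian, *The Selberg–Arthur Trace Formula*, LNM 1503 (1992), §5.1; after Arthur,
Duke Math. J. 45 (1978), §§6–7)

Topic `NumberTheory/Automorphic`; namespace `Literature.NumberTheory.Automorphic.UnitaryGroup`.
DEFINITIONS with bodies and proved structure lemmas; no named fact, no `sorry`, no instance, no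
notation. Companion file `UnitaryGroupArthurTruncatedTrace` integrates `k^T` to `J^T(f)` and states
the two printed facts (integrability, polynomiality in `T`) for `U(J₃)`.

Setting: Mok's / Rogawski's quasi-split unitary group `G = U_{E/F}(N) = U(J_N)`
(`UnitaryGroup.quasiSplit F E c N`), its arithmetic subgroup `G(F)` (`arithmeticSubgroup`), the
rational Borel `B(F)` (`arithmeticBorel`), the unipotent radical `N(𝔸_F) = adelicUnipotent F E c N`
with `N(F) = rationalUnipotent F E c N`, the Borel constant term
`borelConstantTerm ν 𝓕 φ g = ν(𝓕)⁻¹ ∫_𝓕 φ(u g) dν(u)`, the pseudo-Eisenstein sum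
`pseudoEisenstein ψ g = Σ_{δ ∈ B(F)\G(F)} ψ(δ g)` and the multiplicative Iwasawa height
`borelHeight` of `UnitaryGroupBorelHeight` / `UnitaryGroupBorelTruncation` (LETTER #3-qs of the
T1-qs sub-line, which also holds Arthur's truncation OPERATOR `Λ^T` = `truncation`). The present
file types the truncated KERNEL, [Rogawski1990] §2.2 p. 13 with `ε = 1`, `ω = 1`, `Z = 1` (the
centre `Z_G = U(1)_{E/F}` of `U(J_N)` is anisotropic, so Rogawski's `𝐙G\𝐆` is `G(F)\G(𝔸_F)`
itself and `A_G = 1`):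

* §1 `kernel f x y = Σ_{γ ∈ G(F)} f(x⁻¹ γ y)` — the kernel `K(x, y) = K_G(x, y)` of `ρ(f)`
  [Rogawski1990, §2.2 `K_P` with `P = G`; Shokranian1992 §5.1 (i)], with its two-sided
  `G(F)`-invariance PROVED (`kernel_rational_mul_left/right`), and the Borel kernel
  `kernelBorel ν 𝓕 f x y = ν(𝓕)⁻¹ ∫_𝓕 Σ_{β ∈ B(F)} f(x⁻¹ β u y) dν(u)` — for a Haar measure `ν` of
  `N(𝔸_F)` and a fundamental domain `𝓕` of `N(F)` this is
  `∫_{N(F)\N(𝔸_F)} Σ_{β ∈ B(F)} f(x⁻¹ β n y) dn = Σ_{γ ∈ T(F)} ∫_{N(𝔸_F)} f(x⁻¹ γ n y) dn`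
  (`B(F) = T(F) N(F)`, `vol(N(F)\N(𝔸_F)) = 1`), i.e. `K_B(x, y)` of [Rogawski1990] §2.2 /
  [Shokranian1992] §5.1 (iii) — recorded, not asserted; left `B(F)`-invariance in `x` PROVED.
* §2 `truncatedKernel ν 𝓕 T f x = K(x, x) − Σ_{δ ∈ B(F)\G(F)} 1_{H(δx) > T} K_B(δx, δx)` —
  Arthur's `k^T(x) = Σ_P (−1)^{a(P)} Σ_{δ ∈ P\G} K_P(δx, δx) τ̂_P(H(δx) − T)` for `𝒫 = {G, B}`
  (`F`-rank one: `N = 2, 3`; for `N ≥ 4` this is only the `P ∈ {G, B}` part of the alternating sum —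
  recorded, not asserted, exactly as for `truncation`). The cut-off is multiplicative: `T : ℝ≥0`
  against `borelHeight`, so Arthur's additive parameter is `log T`. `G(F)`-invariance of `k^T` is
  PROVED modulo the `B(F)`-invariance of the diagonal of `K_B` (`truncatedKernel_rational_mul`;
  that invariance is the product formula `δ_B(γ) = 1`, `γ ∈ T(F)`, not re-proved here), via the
  new structure lemma `pseudoEisenstein_rational_mul` (`Ψ_ψ(γ g) = Ψ_ψ(g)` for `γ ∈ G(F)`).

What is NOT done here: the `B(F)`-invariance of `y ↦ K_B(y, y)`, the equality
`∫ k^T = ∫ Λ^T_2 K(x, x)` [Shokranian1992 Thm. (7.9)(ii)], the `𝔬`-expansion `k^T = Σ_𝔬 k^T_𝔬`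
[Rogawski1990 §2.2 p. 13].

## References

* J. D. Rogawski, *Automorphic Representations of Unitary Groups in Three Variables*, Annals of
  Mathematics Studies 123 (1990), §2.2 (pp. 12–14: `K_P`, `k^T`) [Rogawski1990].
* S. Shokranian, *The Selberg–Arthur Trace Formula*, LNM 1503 (1992), §5.1 (kernels (i)–(vi))
  [Shokranian1992].
* J. Arthur, *A trace formula for reductive groups I*, Duke Math. J. 45 (1978), §§6–7 — cited
  through the two held expositions above.
* P. Garrett, *Modern Analysis of Automorphic Forms by Example* (2018), §2.10 (pseudo-Eisenstein
  series) [Garrett2018].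
-/

noncomputable section

open MeasureTheory NumberField IsDedekindDomain
open scoped NNReal ENNReal

namespace Literature.NumberTheory.Automorphic

namespace UnitaryGroup

variable {F E : Type} [Field F] [NumberField F] [Field E] [NumberField E] [Algebra F E]
  {c : E ≃ₐ[F] E} {N : ℕ}

/-! ## §1 The kernel `K(x, y)` and the Borel kernel `K_B(x, y)` -/

section Kernel

/-- **The kernel of `ρ(f)`**: `K(x, y) = Σ_{γ ∈ G(F)} f(x⁻¹ γ y)`, summed over the arithmetic
subgroup `G(F) ≤ U(J_N)(𝔸_F)` (Rogawski (1990), §2.2, `K_P` for `P = G` with `ε = 1`;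
Shokranian (1992), §5.1 (i); Gelbart (1975), (9.20)). Junk value `0` when the family is not summable
(for `f` continuous of compact support the sum is finite: `G(F)` is discrete).
[cite: Rogawski1990, §2.2 (p. 13)] -/
def kernel (f : (quasiSplit F E c N).Adelic → ℂ) (x y : (quasiSplit F E c N).Adelic) : ℂ :=
  ∑' γ : (quasiSplit F E c N).arithmeticSubgroup, f (x⁻¹ * (γ : (quasiSplit F E c N).Adelic) * y)

/-- Unfolding `kernel`. [cite: Rogawski1990, §2.2 (p. 13)] -/
theorem kernel_def (f : (quasiSplit F E c N).Adelic → ℂ) (x y : (quasiSplit F E c N).Adelic) :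
    kernel f x y =
      ∑' γ : (quasiSplit F E c N).arithmeticSubgroup, f (x⁻¹ * (γ : (quasiSplit F E c N).Adelic) * y) :=
  rfl

/-- `K_0 = 0`. [cite: Rogawski1990, §2.2 (p. 13)] -/
@[simp] theorem kernel_zero (x y : (quasiSplit F E c N).Adelic) :
    kernel (0 : (quasiSplit F E c N).Adelic → ℂ) x y = 0 := by
  simp [kernel]

/-- The kernel is homogeneous in `f`: `K_{a f} = a K_f`. [cite: Rogawski1990, §2.2 (p. 13)] -/
theorem kernel_smul (a : ℂ) (f : (quasiSplit F E c N).Adelic → ℂ) (x y : (quasiSplit F E c N).Adelic) :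
    kernel (a • f) x y = a * kernel f x y := by
  simp only [kernel, Pi.smul_apply, smul_eq_mul]
  exact tsum_mul_left

/-- **Left `G(F)`-invariance in the first variable**: `K(γ x, y) = K(x, y)` for `γ ∈ G(F)`
(re-indexing `γ' ↦ γ⁻¹ γ'`). [cite: Rogawski1990, §2.2 (p. 13)] -/
theorem kernel_rational_mul_left (f : (quasiSplit F E c N).Adelic → ℂ)
    (γ : (quasiSplit F E c N).arithmeticSubgroup) (x y : (quasiSplit F E c N).Adelic) :
    kernel f ((γ : (quasiSplit F E c N).Adelic) * x) y = kernel f x y := by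
  rw [kernel_def, kernel_def]
  conv_rhs => rw [← (Equiv.mulLeft γ⁻¹).tsum_eq]
  refine tsum_congr fun γ' => ?_
  simp only [Equiv.coe_mulLeft, Subgroup.coe_mul, Subgroup.coe_inv, mul_inv_rev, mul_assoc]

/-- **Left `G(F)`-invariance in the second variable**: `K(x, γ y) = K(x, y)` for `γ ∈ G(F)`
(re-indexing `γ' ↦ γ' γ`). [cite: Rogawski1990, §2.2 (p. 13)] -/
theorem kernel_rational_mul_right (f : (quasiSplit F E c N).Adelic → ℂ)
    (γ : (quasiSplit F E c N).arithmeticSubgroup) (x y : (quasiSplit F E c N).Adelic) :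
    kernel f x ((γ : (quasiSplit F E c N).Adelic) * y) = kernel f x y := by
  rw [kernel_def, kernel_def]
  conv_rhs => rw [← (Equiv.mulRight γ).tsum_eq]
  refine tsum_congr fun γ' => ?_
  simp only [Equiv.coe_mulRight, Subgroup.coe_mul, mul_assoc]

/-- The diagonal `x ↦ K(x, x)` is left `G(F)`-invariant. [cite: Rogawski1990, §2.2 (p. 13)] -/
theorem kernel_diag_rational_mul (f : (quasiSplit F E c N).Adelic → ℂ)
    (γ : (quasiSplit F E c N).arithmeticSubgroup) (x : (quasiSplit F E c N).Adelic) :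
    kernel f ((γ : (quasiSplit F E c N).Adelic) * x) ((γ : (quasiSplit F E c N).Adelic) * x) =
      kernel f x x := by
  rw [kernel_rational_mul_left, kernel_rational_mul_right]

/-- **The sum over the rational Borel**: `Σ_{β ∈ B(F)} f(x⁻¹ β z)` — the integrand of the Borel
kernel `K_B` before integration over `N(F)\N(𝔸_F)` (Rogawski (1990), §2.2: `K_P(x, y)` with
`P = B`, the sum over `M_P = T` and the `N(F)`-periodisation of `∫_{𝐍_P}` combined; junk `0` when
not summable). [cite: Rogawski1990, §2.2 (p. 13)] -/
def borelSum (f : (quasiSplit F E c N).Adelic → ℂ) (x z : (quasiSplit F E c N).Adelic) : ℂ :=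
  ∑' β : arithmeticBorel F E c N,
    f (x⁻¹ * (((β : (quasiSplit F E c N).arithmeticSubgroup)) : (quasiSplit F E c N).Adelic) * z)

/-- Unfolding `borelSum`. [cite: Rogawski1990, §2.2 (p. 13)] -/
theorem borelSum_def (f : (quasiSplit F E c N).Adelic → ℂ) (x z : (quasiSplit F E c N).Adelic) :
    borelSum f x z = ∑' β : arithmeticBorel F E c N,
      f (x⁻¹ * (((β : (quasiSplit F E c N).arithmeticSubgroup)) : (quasiSplit F E c N).Adelic) * z) :=
  rfl

/-- `borelSum 0 = 0`. [cite: Rogawski1990, §2.2 (p. 13)] -/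
@[simp] theorem borelSum_zero (x z : (quasiSplit F E c N).Adelic) :
    borelSum (0 : (quasiSplit F E c N).Adelic → ℂ) x z = 0 := by
  simp [borelSum]

/-- Left `B(F)`-invariance of `borelSum` in the first variable (re-indexing `β' ↦ β⁻¹ β'`).
[cite: Rogawski1990, §2.2 (p. 13)] -/
theorem borelSum_rational_borel_mul_left (f : (quasiSplit F E c N).Adelic → ℂ)
    (β : arithmeticBorel F E c N) (x z : (quasiSplit F E c N).Adelic) :
    borelSum f ((((β : (quasiSplit F E c N).arithmeticSubgroup)) : (quasiSplit F E c N).Adelic) * x) z =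
      borelSum f x z := by
  rw [borelSum_def, borelSum_def]
  conv_rhs => rw [← (Equiv.mulLeft β⁻¹).tsum_eq]
  refine tsum_congr fun β' => ?_
  simp only [Equiv.coe_mulLeft, Subgroup.coe_mul, Subgroup.coe_inv, mul_inv_rev, mul_assoc]

/-- Left `B(F)`-invariance of `borelSum` in the second variable (re-indexing `β' ↦ β' β`).
[cite: Rogawski1990, §2.2 (p. 13)] -/
theorem borelSum_rational_borel_mul_right (f : (quasiSplit F E c N).Adelic → ℂ)
    (β : arithmeticBorel F E c N) (x z : (quasiSplit F E c N).Adelic) :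
    borelSum f x ((((β : (quasiSplit F E c N).arithmeticSubgroup)) : (quasiSplit F E c N).Adelic) * z) =
      borelSum f x z := by
  rw [borelSum_def, borelSum_def]
  conv_rhs => rw [← (Equiv.mulRight β).tsum_eq]
  refine tsum_congr fun β' => ?_
  simp only [Equiv.coe_mulRight, Subgroup.coe_mul, mul_assoc]

variable [MeasurableSpace (adelicUnipotent F E c N)]

/-- **The Borel kernel `K_B(x, y)`**: the Borel constant term, in the variable `z`, of
`z ↦ Σ_{β ∈ B(F)} f(x⁻¹ β z)`, evaluated at `y`:
`K_B(x, y) = ν(𝓕)⁻¹ ∫_𝓕 Σ_{β ∈ B(F)} f(x⁻¹ β u y) dν(u)` for a measure `ν` on `N(𝔸_F)` and a set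
`𝓕 ⊆ N(𝔸_F)` (meant: a Haar measure and a fundamental domain of `N(F)`, when this is
`Σ_{γ ∈ T(F)} ∫_{N(𝔸_F)} f(x⁻¹ γ n y) dn` for the Haar measure giving `N(F)\N(𝔸_F)` volume `1`:
Rogawski (1990), §2.2, `K_P(x, y) = Σ_{γ ∈ M_P} ∫_{𝐍_P} f(x⁻¹ γ n y) dn` with `P = B`, `ε = 1`;
Shokranian (1992), §5.1 (iii)). [cite: Rogawski1990, §2.2 (p. 13)] -/
def kernelBorel (ν : Measure (adelicUnipotent F E c N)) (𝓕 : Set (adelicUnipotent F E c N))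
    (f : (quasiSplit F E c N).Adelic → ℂ) (x y : (quasiSplit F E c N).Adelic) : ℂ :=
  borelConstantTerm ν 𝓕 (borelSum f x) y

/-- Unfolding `kernelBorel` through `borelConstantTerm`. [cite: Rogawski1990, §2.2 (p. 13)] -/
theorem kernelBorel_def (ν : Measure (adelicUnipotent F E c N)) (𝓕 : Set (adelicUnipotent F E c N))
    (f : (quasiSplit F E c N).Adelic → ℂ) (x y : (quasiSplit F E c N).Adelic) :
    kernelBorel ν 𝓕 f x y = borelConstantTerm ν 𝓕 (borelSum f x) y := rfl

/-- `K_B(x, y)` as an explicit normalised integral over `𝓕`. [cite: Rogawski1990, §2.2 (p. 13)] -/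
theorem kernelBorel_eq_smul_integral (ν : Measure (adelicUnipotent F E c N))
    (𝓕 : Set (adelicUnipotent F E c N)) (f : (quasiSplit F E c N).Adelic → ℂ)
    (x y : (quasiSplit F E c N).Adelic) :
    kernelBorel ν 𝓕 f x y = ((ν 𝓕).toReal⁻¹ : ℝ) •
      ∫ u in 𝓕, borelSum f x ((u : (quasiSplit F E c N).Adelic) * y) ∂ν := rfl

/-- `K_B` of the zero function vanishes. [cite: Rogawski1990, §2.2 (p. 13)] -/
@[simp] theorem kernelBorel_zero (ν : Measure (adelicUnipotent F E c N))
    (𝓕 : Set (adelicUnipotent F E c N)) (x y : (quasiSplit F E c N).Adelic) :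
    kernelBorel ν 𝓕 (0 : (quasiSplit F E c N).Adelic → ℂ) x y = 0 := by
  rw [kernelBorel_def]
  have h : borelSum (0 : (quasiSplit F E c N).Adelic → ℂ) x = 0 := funext fun z => borelSum_zero x z
  rw [h, borelConstantTerm_zero]

/-- **Left `B(F)`-invariance of `K_B` in the first variable**: `K_B(β x, y) = K_B(x, y)` for
`β ∈ B(F)`. (Invariance in the second variable needs the unimodularity of `N(𝔸_F)` and the product
formula `δ_B(β) = 1`; it is not asserted here.) [cite: Rogawski1990, §2.2 (p. 13)] -/
theorem kernelBorel_rational_borel_mul_left (ν : Measure (adelicUnipotent F E c N))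
    (𝓕 : Set (adelicUnipotent F E c N)) (f : (quasiSplit F E c N).Adelic → ℂ)
    (β : arithmeticBorel F E c N) (x y : (quasiSplit F E c N).Adelic) :
    kernelBorel ν 𝓕 f ((((β : (quasiSplit F E c N).arithmeticSubgroup)) : (quasiSplit F E c N).Adelic) * x) y =
      kernelBorel ν 𝓕 f x y := by
  rw [kernelBorel_def, kernelBorel_def]
  have h : borelSum f ((((β : (quasiSplit F E c N).arithmeticSubgroup)) : (quasiSplit F E c N).Adelic) * x) =
      borelSum f x := funext fun z => borelSum_rational_borel_mul_left f β x z
  rw [h]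

end Kernel

/-! ## §2 Arthur's truncated kernel `k^T(x)` (`F`-rank one) -/

section TruncatedKernel

/-- **`G(F)`-invariance of pseudo-Eisenstein sums**: if `ψ` is left `B(F)`-invariant then
`Ψ_ψ(γ g) = Ψ_ψ(g)` for `γ ∈ G(F)` (right multiplication by `γ` permutes `B(F)\G(F)`).
[cite: Garrett2018, §2.10 (PDF p. 119)] -/
theorem pseudoEisenstein_rational_mul {ψ : (quasiSplit F E c N).Adelic → ℂ}
    (hψ : ∀ b ∈ arithmeticBorel F E c N, ∀ x : (quasiSplit F E c N).Adelic,
      ψ ((b : (quasiSplit F E c N).Adelic) * x) = ψ x)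
    (γ : (quasiSplit F E c N).arithmeticSubgroup) (g : (quasiSplit F E c N).Adelic) :
    pseudoEisenstein ψ ((γ : (quasiSplit F E c N).Adelic) * g) = pseudoEisenstein ψ g := by
  -- right multiplication by `γ` on the right cosets `B(F)\G(F)`
  let e : Quotient (QuotientGroup.rightRel (arithmeticBorel F E c N)) ≃
      Quotient (QuotientGroup.rightRel (arithmeticBorel F E c N)) :=
    Quotient.congr (Equiv.mulRight γ) fun a b => by
      rw [QuotientGroup.rightRel_apply, QuotientGroup.rightRel_apply]
      have h : b * γ * (a * γ)⁻¹ = b * a⁻¹ := by group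
      exact Iff.of_eq (congrArg (· ∈ arithmeticBorel F E c N) h).symm
  rw [pseudoEisenstein_def, pseudoEisenstein_def]
  conv_rhs => rw [← finsum_comp_equiv e]
  refine finsum_congr fun q => ?_
  -- both sides are `ψ` at a representative of the coset `q γ`, times `g`
  induction q using Quotient.inductionOn with
  | h a =>
    have he : e (Quotient.mk _ a) = Quotient.mk (QuotientGroup.rightRel (arithmeticBorel F E c N)) (a * γ) :=
      rfl
    rw [he, pseudoEisenstein_term_eq hψ (a * γ) g, Subgroup.coe_mul, mul_assoc,
      pseudoEisenstein_term_eq hψ a ((γ : (quasiSplit F E c N).Adelic) * g)]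

variable [NeZero N] [MeasurableSpace (adelicUnipotent F E c N)]

/-- **The cut-off Borel diagonal** `y ↦ 1_{H(y) > T} K_B(y, y)` (Rogawski (1990), §2.2: the term
`K_P(δx, δx) τ̂_P(H(δx) − T)` before summation over `δ`; here `H = borelHeight` is multiplicative
and `T : ℝ≥0`). [cite: Rogawski1990, §2.2 (p. 13)] -/
def kernelBorelTail (ν : Measure (adelicUnipotent F E c N)) (𝓕 : Set (adelicUnipotent F E c N))
    (T : ℝ≥0) (f : (quasiSplit F E c N).Adelic → ℂ) : (quasiSplit F E c N).Adelic → ℂ :=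
  Set.indicator {y | T < borelHeight y} fun y => kernelBorel ν 𝓕 f y y

/-- Above the cut-off the tail is `K_B(y, y)`. [cite: Rogawski1990, §2.2 (p. 13)] -/
theorem kernelBorelTail_of_lt {ν : Measure (adelicUnipotent F E c N)} {𝓕 : Set (adelicUnipotent F E c N)}
    {T : ℝ≥0} (f : (quasiSplit F E c N).Adelic → ℂ) {y : (quasiSplit F E c N).Adelic}
    (hy : T < borelHeight y) : kernelBorelTail ν 𝓕 T f y = kernelBorel ν 𝓕 f y y :=
  Set.indicator_of_mem (s := {y | T < borelHeight y}) hy _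

/-- Below the cut-off the tail vanishes. [cite: Rogawski1990, §2.2 (p. 13)] -/
theorem kernelBorelTail_of_not_lt {ν : Measure (adelicUnipotent F E c N)}
    {𝓕 : Set (adelicUnipotent F E c N)} {T : ℝ≥0} (f : (quasiSplit F E c N).Adelic → ℂ)
    {y : (quasiSplit F E c N).Adelic} (hy : ¬T < borelHeight y) : kernelBorelTail ν 𝓕 T f y = 0 :=
  Set.indicator_of_notMem (s := {y | T < borelHeight y}) hy _

/-- The tail of the zero function vanishes. [cite: Rogawski1990, §2.2 (p. 13)] -/
@[simp] theorem kernelBorelTail_zero (ν : Measure (adelicUnipotent F E c N))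
    (𝓕 : Set (adelicUnipotent F E c N)) (T : ℝ≥0) :
    kernelBorelTail ν 𝓕 T (0 : (quasiSplit F E c N).Adelic → ℂ) = 0 := by
  funext y
  by_cases hy : T < borelHeight y
  · rw [kernelBorelTail_of_lt _ hy, kernelBorel_zero, Pi.zero_apply]
  · rw [kernelBorelTail_of_not_lt _ hy, Pi.zero_apply]

/-- **If the diagonal of `K_B` is left `B(F)`-invariant, so is its cut-off tail** (the height is
`B(F)`-invariant by the product formula, ★ `borelHeight_rational_borel_mul`).
[cite: Rogawski1990, §2.2 (p. 13)] -/
theorem kernelBorelTail_rational_borel_mul {ν : Measure (adelicUnipotent F E c N)}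
    {𝓕 : Set (adelicUnipotent F E c N)} {f : (quasiSplit F E c N).Adelic → ℂ}
    (hK : ∀ b ∈ arithmeticBorel F E c N, ∀ y : (quasiSplit F E c N).Adelic,
      kernelBorel ν 𝓕 f ((b : (quasiSplit F E c N).Adelic) * y) ((b : (quasiSplit F E c N).Adelic) * y) =
        kernelBorel ν 𝓕 f y y)
    (T : ℝ≥0) (b : (quasiSplit F E c N).arithmeticSubgroup) (hb : b ∈ arithmeticBorel F E c N)
    (y : (quasiSplit F E c N).Adelic) :
    kernelBorelTail ν 𝓕 T f ((b : (quasiSplit F E c N).Adelic) * y) = kernelBorelTail ν 𝓕 T f y := by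
  obtain ⟨γ, hγ⟩ := b.2
  have hγB : (quasiSplit F E c N).toAdelic γ ∈ borelAdelic F E c N := by
    rw [hγ]; exact (mem_arithmeticBorel_iff b).1 hb
  have hH : borelHeight ((b : (quasiSplit F E c N).Adelic) * y) = borelHeight y := by
    rw [← hγ]; exact borelHeight_rational_borel_mul γ hγB y
  by_cases hy : T < borelHeight y
  · rw [kernelBorelTail_of_lt _ hy, kernelBorelTail_of_lt _ (by rwa [hH]), hK b hb y]
  · rw [kernelBorelTail_of_not_lt _ hy, kernelBorelTail_of_not_lt _ (by rwa [hH])]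

/-- **Arthur's truncated kernel in `F`-rank one**, along the Borel subgroup of `U(J_N)`:
`k^T(x) = K(x, x) − Σ_{δ ∈ B(F)\G(F)} 1_{H(δx) > T} K_B(δx, δx)`
(Rogawski (1990), §2.2 p. 13: `k^T(x) = Σ_{P} (−1)^{a(P, ε)} Σ_{δ ∈ P\G} K_P(δx, δx) τ̂_{P,ε}(H(δx) − T)`
with `ε = 1`, `𝒫 = {G, B}`, `a(G) = 0`, `a(B) = 1`; Shokranian (1992), §5.1 (v)–(vi)). The sum over
`δ` is the pseudo-Eisenstein sum of `UnitaryGroupBorelTruncation` (a `finsum`, junk `0` when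
infinitely many terms are non-zero — for `f ∈ C_c(G(𝔸_F))` and fixed `x` only finitely many are,
loc. cit.: «The sums over `δ` and `γ` … are finite»). For `N = 2, 3` this is the full truncated
kernel; for `N ≥ 4` only the terms `P ∈ {G, B}` of Arthur's alternating sum — recorded, not
asserted. [cite: Rogawski1990, §2.2 (p. 13)] -/
def truncatedKernel (ν : Measure (adelicUnipotent F E c N)) (𝓕 : Set (adelicUnipotent F E c N))
    (T : ℝ≥0) (f : (quasiSplit F E c N).Adelic → ℂ) (x : (quasiSplit F E c N).Adelic) : ℂ :=
  kernel f x x - pseudoEisenstein (kernelBorelTail ν 𝓕 T f) x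

/-- Unfolding `truncatedKernel`. [cite: Rogawski1990, §2.2 (p. 13)] -/
theorem truncatedKernel_def (ν : Measure (adelicUnipotent F E c N)) (𝓕 : Set (adelicUnipotent F E c N))
    (T : ℝ≥0) (f : (quasiSplit F E c N).Adelic → ℂ) (x : (quasiSplit F E c N).Adelic) :
    truncatedKernel ν 𝓕 T f x = kernel f x x - pseudoEisenstein (kernelBorelTail ν 𝓕 T f) x := rfl

/-- `k^T` of the zero function vanishes. [cite: Rogawski1990, §2.2 (p. 13)] -/
@[simp] theorem truncatedKernel_zero (ν : Measure (adelicUnipotent F E c N))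
    (𝓕 : Set (adelicUnipotent F E c N)) (T : ℝ≥0) (x : (quasiSplit F E c N).Adelic) :
    truncatedKernel ν 𝓕 T (0 : (quasiSplit F E c N).Adelic → ℂ) x = 0 := by
  rw [truncatedKernel_def, kernel_zero, kernelBorelTail_zero, pseudoEisenstein_zero, sub_zero]

/-- **Below the cut-off everywhere, `k^T(x) = K(x, x)`**: if no translate `δ x`, `δ ∈ G(F)`, has
height above `T`, the correction term vanishes (Shokranian (1992), Example (5.2): for `x` in a
fixed compact set and `T` large, `k^T(x) = K(x, x)`). [cite: Shokranian1992, §5.1 Example (5.2)] -/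
theorem truncatedKernel_eq_kernel_of_forall_le {ν : Measure (adelicUnipotent F E c N)}
    {𝓕 : Set (adelicUnipotent F E c N)} {T : ℝ≥0} (f : (quasiSplit F E c N).Adelic → ℂ)
    {x : (quasiSplit F E c N).Adelic}
    (hx : ∀ γ : (quasiSplit F E c N).arithmeticSubgroup,
      borelHeight ((γ : (quasiSplit F E c N).Adelic) * x) ≤ T) :
    truncatedKernel ν 𝓕 T f x = kernel f x x := by
  rw [truncatedKernel_def, pseudoEisenstein_def, sub_eq_self]
  refine finsum_eq_zero_of_forall_eq_zero fun q => ?_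
  exact kernelBorelTail_of_not_lt _ (not_lt.2 (hx _))

/-- **`k^T` is left `G(F)`-invariant** — granted the `B(F)`-invariance of the diagonal of `K_B`
(unimodularity of `N(𝔸_F)` and the product formula `δ_B(γ) = 1` on `T(F)`; an input, not proved
here): `k^T(γ x) = k^T(x)` for `γ ∈ G(F)` (`kernel_diag_rational_mul`, `pseudoEisenstein_rational_mul`).
[cite: Rogawski1990, §2.2 (p. 13)] -/
theorem truncatedKernel_rational_mul {ν : Measure (adelicUnipotent F E c N)}
    {𝓕 : Set (adelicUnipotent F E c N)} {f : (quasiSplit F E c N).Adelic → ℂ}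
    (hK : ∀ b ∈ arithmeticBorel F E c N, ∀ y : (quasiSplit F E c N).Adelic,
      kernelBorel ν 𝓕 f ((b : (quasiSplit F E c N).Adelic) * y) ((b : (quasiSplit F E c N).Adelic) * y) =
        kernelBorel ν 𝓕 f y y)
    (T : ℝ≥0) (γ : (quasiSplit F E c N).arithmeticSubgroup) (x : (quasiSplit F E c N).Adelic) :
    truncatedKernel ν 𝓕 T f ((γ : (quasiSplit F E c N).Adelic) * x) = truncatedKernel ν 𝓕 T f x := by
  rw [truncatedKernel_def, truncatedKernel_def, kernel_diag_rational_mul,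
    pseudoEisenstein_rational_mul (fun b hb y => kernelBorelTail_rational_borel_mul hK T b hb y)]

/-- Under the same input `k^T` is invariant under the whole quotient subgroup `A_G · G(F) = G(F)`
(`A_G = 1` for unitary groups), the hypothesis of the descent lemma `quotFun_toAutomorphicQuotient`.
[cite: Rogawski1990, §2.2 (p. 13)] -/
theorem truncatedKernel_quotientSubgroup_mul {ν : Measure (adelicUnipotent F E c N)}
    {𝓕 : Set (adelicUnipotent F E c N)} {f : (quasiSplit F E c N).Adelic → ℂ}
    (hK : ∀ b ∈ arithmeticBorel F E c N, ∀ y : (quasiSplit F E c N).Adelic,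
      kernelBorel ν 𝓕 f ((b : (quasiSplit F E c N).Adelic) * y) ((b : (quasiSplit F E c N).Adelic) * y) =
        kernelBorel ν 𝓕 f y y)
    (T : ℝ≥0) (γ : (quasiSplit F E c N).Adelic) (hγ : γ ∈ (quasiSplit F E c N).quotientSubgroup)
    (x : (quasiSplit F E c N).Adelic) :
    truncatedKernel ν 𝓕 T f (γ * x) = truncatedKernel ν 𝓕 T f x := by
  have hγ' : γ ∈ (quasiSplit F E c N).arithmeticSubgroup := by
    have h : (quasiSplit F E c N).quotientSubgroup = (quasiSplit F E c N).arithmeticSubgroup := by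
      rw [AdelicGroupData.quotientSubgroup, show (quasiSplit F E c N).center' = ⊥ from rfl, bot_sup_eq]
    rwa [h] at hγ
  exact truncatedKernel_rational_mul hK T ⟨γ, hγ'⟩ x

end TruncatedKernel

end UnitaryGroup

end Literature.NumberTheory.Automorphic
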